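import Summits.QuantumFields.GaugeBoot.TiltedBoxReducedHalfUniformWindow
import Summits.QuantumFields.GaugeBoot.TiltedBoxLimitDLR
import Summits.QuantumFields.GaugeBoot.ClassBStrongCoupling
import HarnessLib

/-!
# Tilted limit points at strong coupling: full in-plane axis RP in the limit while every box fails (gauge-boot, L3 supplement)

HONEST FRAMING (cell `pub-gaugeboot`, page 1 of every file): the venture produces certified bounds
on lattice expectations at stated coupling, gauge group, dimension and torus size; NOT a mass gap,
NOT a continuum limit, NOT a string tension; NOT Yang–Mills-summit-bearing (barriers
`FixedCouplingUltralocality`, `PerturbativeInvisibility`). This module is a STRONG-COUPLING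
statement about lattice states; nothing is claimed at the couplings of the cell's certificates.

## Content

`TiltedBoxLimitDLR.lean` (gen 40) proved the bridge `|𝒢_θ(β)| ≤ 1 ⇒` every cubic-torus limit point
is a tilted limit point and `ThermodynamicLimitIsClassB`; `ClassBStrongCoupling.lean` (gen 2) has
DLR uniqueness `|𝒢(β)| ≤ 1` for `SU(N)` at strong coupling (Shen–Zhu–Zhu, as proved in the tree).
Put together, for the record of the tilted-box programme:

* **`exists_classBState_eq_of_mem_tiltedBoxLimitPoints_of_subsingleton_TI`** — under `|𝒢_θ(β)| ≤ 1`
  (implied by `|𝒢(β)| ≤ 1`, tree lemma `subsingleton_ymGibbsMeasuresTI_of_subsingleton`)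
  (`β ≥ 0`) every TILTED limit point underlies a Class-B state; hence
  **`axisRP_of_mem_tiltedBoxLimitPoints_of_subsingleton_TI`** — it is site-RP AND link-RP along
  EVERY axis, the in-plane axes `i`, `j` included (for a general tilted limit point only the
  transverse axes `k ∉ {i, j}` are known, `TiltedBoxLimitAxisRP.lean`);
* **`exists_classBState_eq_of_mem_tiltedBoxLimitPoints_SU_strongCoupling`** /
  **`axisRP_of_mem_tiltedBoxLimitPoints_SU_strongCoupling`** — `SU(N)`, `d ≥ 2`, `N ≥ 2`, bare
  coupling `Nβ` with `0 ≤ β < 1/(16(d-1))`: unconditionally;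
* ★ **`boxes_fail_limit_holds_inPlaneRP_suN`** — THE CONTRAST, `SU(N)` (`N ≥ 2`) with a transverse
  axis `k ∉ {i, j}` (`d ≥ 3`): there is `β₁ = β₁(d, N) > 0` such that for every `0 < β ≤ β₁`
  (bare coupling) (a) on EVERY square tilted box of the plane `(i, j)` (`P ≥ 2`, `L ≥ 2`) the
  reduced-half in-plane mirrors along `i` FAIL to be reflection positive (site mirror of the even
  box, link mirror of the odd box: `TiltedBoxReducedHalfUniformWindow`), YET (b) every tilted LIMIT
  point of that plane at the same coupling IS site-RP and link-RP along `i` (and along every axis).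
  So at small coupling the failure of the in-plane mirrors is a pure finite-volume (twist) effect
  that disappears in the infinite-volume limit — and no finite-volume inheritance argument could
  have shown (b).

Nothing here decides the in-plane axis RP of tilted limit points OUTSIDE the uniqueness window.
-/

noncomputable section

open MeasureTheory Filter Topology
open scoped ComplexConjugate ComplexOrder
open Literature.MathematicalPhysics.QuantumLattice
open Literature.MathematicalPhysics.QuantumFieldTheory (subsingleton_ymGibbsMeasures_SU_strongCoupling)

namespace Summit.QuantumFields.GaugeBoot

namespace TiltedRP

/-! ## Under uniqueness of the translation-invariant DLR state -/

section Subsingleton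

variable {d : ℕ} {i j : Fin d} {N : ℕ}
variable {G : Type*} [Group G] [TopologicalSpace G] [IsTopologicalGroup G] [CompactSpace G]
  [MeasurableSpace G] [BorelSpace G] [T2Space G] [SecondCountableTopology G]
variable (ρ : G →* Matrix (Fin N) (Fin N) ℂ)

/-- **Under `|𝒢_θ(β)| ≤ 1` every tilted limit point underlies a Class-B state** (`β ≥ 0`, `d ≥ 1`):
it is a cubic-torus limit point (`tiltedBoxLimitPoints_eq_infiniteVolumeLimitPoints_of_subsingleton_TI`)
and `ThermodynamicLimitIsClassB` holds (`thermodynamicLimitIsClassB_of_subsingleton_TI`). [folklore] -/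
theorem exists_classBState_eq_of_mem_tiltedBoxLimitPoints_of_subsingleton_TI [NeZero d]
    (hρ : Continuous ρ) {β : ℝ} (hβ : 0 ≤ β)
    (hsub : (ymGibbsMeasuresTI (d := d) ρ β).Subsingleton) {μ : Measure (LGConfig d G)}
    (hμ : μ ∈ tiltedBoxLimitPoints d i j ρ β) : ∃ ω : ClassBState d ρ β, ω.μ = μ := by
  have hμ' : μ ∈ infiniteVolumeLimitPoints (d := d) ρ β := by
    rw [← tiltedBoxLimitPoints_eq_infiniteVolumeLimitPoints_of_subsingleton_TI (i := i) (j := j) ρ hρ hsub]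
    exact hμ
  exact thermodynamicLimitIsClassB_of_subsingleton_TI ρ hρ hβ hsub μ hμ'

/-- **Under `|𝒢_θ(β)| ≤ 1` a tilted limit point is site-RP and link-RP along EVERY axis** — the
in-plane axes `i`, `j` included (`β ≥ 0`). [folklore] -/
theorem axisRP_of_mem_tiltedBoxLimitPoints_of_subsingleton_TI [NeZero d] (hρ : Continuous ρ)
    {β : ℝ} (hβ : 0 ≤ β) (hsub : (ymGibbsMeasuresTI (d := d) ρ β).Subsingleton)
    {μ : Measure (LGConfig d G)} (hμ : μ ∈ tiltedBoxLimitPoints d i j ρ β) (k : Fin d) :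
    IsReflectionPositiveFor (configSiteReflect (G := G) k) (siteHalfEdges k) μ ∧
      IsReflectionPositiveFor (configLinkReflect (G := G) k) (linkHalfEdges k) μ := by
  obtain ⟨ω, hω⟩ := exists_classBState_eq_of_mem_tiltedBoxLimitPoints_of_subsingleton_TI ρ hρ hβ hsub hμ
  exact ⟨hω ▸ ω.siteRP k, hω ▸ ω.linkRP k⟩

end Subsingleton

/-! ## `SU(N)` at strong coupling -/

section SpecialUnitary

variable {d N : ℕ} {i j : Fin d}

/-- **`SU(N)` at strong coupling: every tilted limit point is a Class-B state** (`d ≥ 2`, `N ≥ 2`,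
bare coupling `Nβ` with `0 ≤ β < 1/(16(d-1))`; DLR uniqueness of Shen–Zhu–Zhu as proved in the
tree, `subsingleton_ymGibbsMeasures_SU_strongCoupling`). [folklore] -/
theorem exists_classBState_eq_of_mem_tiltedBoxLimitPoints_SU_strongCoupling (hd : 2 ≤ d)
    (hN : 2 ≤ N) {β : ℝ} (hβ0 : 0 ≤ β) (hβ : β < 1 / (16 * ((d : ℝ) - 1)))
    {μ : Measure (LGConfig d (Matrix.specialUnitaryGroup (Fin N) ℂ))}
    (hμ : μ ∈ tiltedBoxLimitPoints d i j (fundamentalRep (Fin N)) (N * β)) :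
    ∃ ω : ClassBState d (fundamentalRep (Fin N)) (N * β), ω.μ = μ := by
  haveI : NeZero d := ⟨by omega⟩
  haveI : SecondCountableTopology (Matrix (Fin N) (Fin N) ℂ) :=
    inferInstanceAs (SecondCountableTopology (Fin N → Fin N → ℂ))
  haveI : SecondCountableTopology (Matrix.specialUnitaryGroup (Fin N) ℂ) :=
    Topology.IsEmbedding.subtypeVal.secondCountableTopology
  have hN0 : (0 : ℝ) ≤ N := Nat.cast_nonneg N
  exact exists_classBState_eq_of_mem_tiltedBoxLimitPoints_of_subsingleton_TI (fundamentalRep (Fin N))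
    (continuous_fundamentalRep (Fin N)) (mul_nonneg hN0 hβ0)
    (subsingleton_ymGibbsMeasuresTI_of_subsingleton (fundamentalRep (Fin N))
      (subsingleton_ymGibbsMeasures_SU_strongCoupling hd hN (abs_lt.2 ⟨by linarith, hβ⟩))) hμ

/-- **`SU(N)` at strong coupling: every tilted limit point is site-RP and link-RP along EVERY
axis**, the in-plane axes included (`d ≥ 2`, `N ≥ 2`, bare coupling `Nβ`, `0 ≤ β < 1/(16(d-1))`).
[folklore] -/
theorem axisRP_of_mem_tiltedBoxLimitPoints_SU_strongCoupling (hd : 2 ≤ d) (hN : 2 ≤ N) {β : ℝ}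
    (hβ0 : 0 ≤ β) (hβ : β < 1 / (16 * ((d : ℝ) - 1)))
    {μ : Measure (LGConfig d (Matrix.specialUnitaryGroup (Fin N) ℂ))}
    (hμ : μ ∈ tiltedBoxLimitPoints d i j (fundamentalRep (Fin N)) (N * β)) (k : Fin d) :
    IsReflectionPositiveFor (configSiteReflect (G := Matrix.specialUnitaryGroup (Fin N) ℂ) k)
        (siteHalfEdges k) μ ∧
      IsReflectionPositiveFor (configLinkReflect (G := Matrix.specialUnitaryGroup (Fin N) ℂ) k)
        (linkHalfEdges k) μ := by
  obtain ⟨ω, hω⟩ := exists_classBState_eq_of_mem_tiltedBoxLimitPoints_SU_strongCoupling hd hN hβ0 hβ hμ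
  exact ⟨hω ▸ ω.siteRP k, hω ▸ ω.linkRP k⟩

/-- ★ **THE CONTRAST (`SU(N)`, `N ≥ 2`, a transverse axis `k ∉ {i, j}`, so `d ≥ 3`).** There is
`β₁ = β₁(d, N) > 0` such that for every bare coupling `0 < β ≤ β₁`:
(a) on EVERY square tilted box of the plane `(i, j)` (`P ≥ 2`, `L ≥ 2`) the reduced-half in-plane
mirrors along `i` are NOT reflection positive — neither the site mirror of the even box
`ℤ^d/Γ(2P, 2P, L)` nor the link mirror of the odd box `ℤ^d/Γ(2P+1, 2P+1, L)`
(`inPlaneMirrors_reduced_uniform_suN`); YET (b) every tilted LIMIT point of the plane `(i, j)` at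
the same coupling IS site-RP and link-RP along `i` (indeed along every axis; DLR uniqueness at strong
coupling). At small coupling the failure of the in-plane mirrors on the boxes is thus a pure
finite-volume twist effect, invisible in the infinite-volume limit — and (b) is not reachable by
inheritance from the boxes. [folklore] -/
theorem boxes_fail_limit_holds_inPlaneRP_suN {k : Fin d} (hij : i ≠ j) (hki : k ≠ i) (hkj : k ≠ j)
    (hN : 2 ≤ N) :
    ∃ β₁ : ℝ, 0 < β₁ ∧ ∀ β : ℝ, 0 < β → β ≤ β₁ →
      (∀ (P L : ℕ) [NeZero P] [NeZero L], 2 ≤ P → 2 ≤ L →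
        ¬ RedSite.RedSiteRP d i j L P (G := Matrix.specialUnitaryGroup (Fin N) ℂ)
            (fundamentalRep (Fin N)) hij β ∧
          ¬ RedLink.RedLinkRP d i j L P (G := Matrix.specialUnitaryGroup (Fin N) ℂ)
            (fundamentalRep (Fin N)) hij β) ∧
      (∀ μ ∈ tiltedBoxLimitPoints d i j (fundamentalRep (Fin N)) β,
        IsReflectionPositiveFor (configSiteReflect (G := Matrix.specialUnitaryGroup (Fin N) ℂ) i)
            (siteHalfEdges i) μ ∧
          IsReflectionPositiveFor (configLinkReflect (G := Matrix.specialUnitaryGroup (Fin N) ℂ) i)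
            (linkHalfEdges i) μ) := by
  have hd : 2 ≤ d := by
    have h1 := i.isLt; have h2 := j.isLt; have h3 : i.val ≠ j.val := Fin.val_ne_of_ne hij; omega
  have hd' : (2 : ℝ) ≤ d := by exact_mod_cast hd
  have hNr : (2 : ℝ) ≤ N := by exact_mod_cast hN
  have hN0 : (0 : ℝ) < N := by linarith
  have hD : (0 : ℝ) < 32 * ((d : ℝ) - 1) := by linarith
  obtain ⟨β₀, hβ₀, hbox⟩ := (inPlaneMirrors_reduced_uniform_suN (d := d) (N := N) hij hN).2 k hki hkj
  refine ⟨min β₀ (N / (32 * ((d : ℝ) - 1))), lt_min hβ₀ (div_pos hN0 hD), fun β hβ hβ1 => ⟨?_, ?_⟩⟩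
  · intro P L _ _ hP hL
    exact hbox P L hP hL β hβ (hβ1.trans (min_le_left _ _))
  · intro μ hμ
    have hβN : β ≤ N / (32 * ((d : ℝ) - 1)) := hβ1.trans (min_le_right _ _)
    rw [le_div_iff₀ hD] at hβN
    have hγ0 : 0 ≤ β / N := div_nonneg hβ.le hN0.le
    have hγ : β / N < 1 / (16 * ((d : ℝ) - 1)) := by
      rw [div_lt_div_iff₀ hN0 (by linarith), one_mul]
      nlinarith
    have hNγ : (N : ℝ) * (β / N) = β := mul_div_cancel₀ β hN0.ne'
    have hμ' : μ ∈ tiltedBoxLimitPoints d i j (fundamentalRep (Fin N)) (N * (β / N)) := by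
      rw [hNγ]; exact hμ
    exact axisRP_of_mem_tiltedBoxLimitPoints_SU_strongCoupling hd hN hγ0 hγ hμ' i

end SpecialUnitary

end TiltedRP

end Summit.QuantumFields.GaugeBoot

end
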